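import Literature.Analysis.FluidPDE.EnergyToolkit
import Summits.AnomalousDissipation.AnomalousDissipation.Theorems.SawtoothPulseCascadeK1LocalisedCascadeSlotPullback
import Summits.AnomalousDissipation.AnomalousDissipation.Theorems.SawtoothPulseCascadeK1LocalisedCascadeSlotParseval

/-!
# K1loc, line `Spectral` / SeqCone — helper: TOOLS FOR THE SLOT PAIRING (product rules with functions of the
# driving coordinate, skewness of the slot derivative, `L²` Cauchy–Schwarz, norms of the real polynomial `h`)

Third S3b helper file of the prover lane on the crux `K1LocalisedCascade` (stmt-AnomalousDissipation-19491), route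
`SawtoothPulseCascade` (architecture note `K1loc-architecture-findings-k1locp1.md`, F-b), on `𝕋²` with `i ≠ j`:
* `partialDeriv_i/j_onCircle_mul` — product rules for `Y(x_j)·b`; `partialDeriv_onCircle_comp_eq` — the slope
  `∂ⱼ(x ↦ φ(x_j)) = Q(x_j)` when `Q = φ'`;
* `integral_partialDeriv_mul_add`, `integral_slotDeriv_mul_add` — integration by parts / skewness of the slot
  derivative `D̄ = ∂ⱼ − cQ(x_j)∂ᵢ` (`∫ D̄a·b + ∫ a·D̄b = 0`);
* `abs_integral_mul_le`, `sqrt_integral_sq_le_of_abs_le` — `L²` Cauchy–Schwarz and pointwise domination;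
* `sqrt_integral_reTrig_sq_le`, `sqrt_integral_dirDeriv_reTrig_sq_le` — `‖h‖ ≤ √(∑_{k∈S} w|𝓕F|²)`,
  `‖D_α h‖ ≤ ‖D_α F‖` for `h = Re ∑_{k∈S} w 𝓕F e_k`, `0 ≤ w ≤ 1` (from `…SlotParseval`).
WHAT THIS IS NOT: no statement about the cascade or the stub itself; no definitions.
[cite: Grafakos2014, Prop. 3.2.7 (3) (Parseval on `T^d`)]
[cite: BedrossianCotiZelati2017, §2 (energy method in shear coordinates)] [problem: turb]
-/

-- `Summit.<Summit>.<Problem>`: single-conjunct summit, the duplicate namespace segment is deliberate.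
set_option linter.dupNamespace false

noncomputable section

namespace Summit.AnomalousDissipation.AnomalousDissipation.Theorems.SawtoothPulseCascade.K1Slot

open MeasureTheory Set Filter Topology UnitAddTorus Function
open scoped ContDiff InnerProductSpace
open Literature.Analysis Literature.Analysis.FunctionSpaces Literature.Analysis.FunctionSpaces.Torus
open Literature.Analysis.FluidPDE.ShearStage

-- BODY

section Pairing

open scoped ComplexConjugate

variable {i j : Fin 2}

/-! ## §1 Product rules with functions of the driving coordinate, skewness of the slot derivative -/

/-- The slope `∂ⱼ(x ↦ φ(x_j))` is `φ'(x_j)`: if `Q = φ'` as profiles, `∂ⱼ(x ↦ φ(x_j)) x = Q(x_j)`. [folklore] -/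
theorem partialDeriv_onCircle_comp_eq (P Q : ShearProfile) (hQ : ∀ y, Q y = deriv P y) (x : UnitAddTorus (Fin 2)) :
    partialDeriv j (fun x : UnitAddTorus (Fin 2) => P.onCircle (x j)) x = Q.onCircle (x j) := by
  obtain ⟨y, rfl⟩ := proj_surjective x
  rw [partialDeriv_onCircle_comp, if_pos rfl, proj_apply, ShearProfile.onCircle_coe, hQ]

/-- `∂ᵢ (Y(x_j) b) = Y(x_j) ∂ᵢ b` (`i ≠ j`). [folklore] -/
theorem partialDeriv_i_onCircle_mul (hij : i ≠ j) (Y : ShearProfile) {b : UnitAddTorus (Fin 2) → ℝ}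
    (hb : IsSmooth b) (x : UnitAddTorus (Fin 2)) :
    partialDeriv i (fun x : UnitAddTorus (Fin 2) => Y.onCircle (x j) * b x) x = Y.onCircle (x j) * partialDeriv i b x := by
  have hY : IsSmooth (fun x : UnitAddTorus (Fin 2) => Y.onCircle (x j)) := isSmooth_onCircle_comp' Y j
  rw [partialDeriv_mul (hY.isContDiff (by simp)) (hb.isContDiff (by simp)),
    partialDeriv_onCircle_comp_of_ne Y hij, zero_mul, add_zero]

/-- `∂ⱼ (Y(x_j) b) = Y(x_j) ∂ⱼ b + Y'(x_j) b`. [folklore] -/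
theorem partialDeriv_j_onCircle_mul (Y : ShearProfile) {b : UnitAddTorus (Fin 2) → ℝ} (hb : IsSmooth b)
    (x : UnitAddTorus (Fin 2)) :
    partialDeriv j (fun x : UnitAddTorus (Fin 2) => Y.onCircle (x j) * b x) x =
      Y.onCircle (x j) * partialDeriv j b x +
        partialDeriv j (fun x : UnitAddTorus (Fin 2) => Y.onCircle (x j)) x * b x := by
  have hY : IsSmooth (fun x : UnitAddTorus (Fin 2) => Y.onCircle (x j)) := isSmooth_onCircle_comp' Y j
  rw [partialDeriv_mul (hY.isContDiff (by simp)) (hb.isContDiff (by simp))]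

/-- Integration by parts on the torus: `∫ ∂_l a · b + ∫ a · ∂_l b = 0`. [folklore] -/
theorem integral_partialDeriv_mul_add {a b : UnitAddTorus (Fin 2) → ℝ} (ha : IsSmooth a) (hb : IsSmooth b)
    (l : Fin 2) : (∫ x, partialDeriv l a x * b x) + ∫ x, a x * partialDeriv l b x = 0 := by
  have hab : IsSmooth (fun y => a y * b y) := ha.mul hb
  have h0 : ∫ x, partialDeriv l (fun y => a y * b y) x = 0 := integral_partialDeriv_eq_zero_holds hab l
  have e : (fun x => partialDeriv l (fun y => a y * b y) x) =
      fun x => a x * partialDeriv l b x + partialDeriv l a x * b x :=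
    funext fun x => partialDeriv_mul (ha.isContDiff (by simp)) (hb.isContDiff (by simp)) l x
  have hi1 : Integrable (fun x => a x * partialDeriv l b x) volume :=
    (ha.continuous.mul (hb.partialDeriv l).continuous).integrable_unitAddTorus
  have hi2 : Integrable (fun x => partialDeriv l a x * b x) volume :=
    ((ha.partialDeriv l).continuous.mul hb.continuous).integrable_unitAddTorus
  rw [e, integral_add hi1 hi2] at h0
  linarith

/-- Smoothness of the slot derivative `D̄b = ∂ⱼb − cQ(x_j)∂ᵢb`. [folklore] -/
theorem isSmooth_slotDeriv (Q : ShearProfile) (c : ℝ) {b : UnitAddTorus (Fin 2) → ℝ} (hb : IsSmooth b) :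
    IsSmooth (fun x : UnitAddTorus (Fin 2) => partialDeriv j b x - c * Q.onCircle (x j) * partialDeriv i b x) := by
  have h : IsSmooth (fun x : UnitAddTorus (Fin 2) => c * Q.onCircle (x j) * partialDeriv i b x) :=
    ((isSmooth_const (d := Fin 2) c).mul (isSmooth_onCircle_comp' Q j)).mul (hb.partialDeriv i)
  exact (hb.partialDeriv j).sub h

/-- **Skewness of the slot derivative**: `∫ D̄a · b + ∫ a · D̄b = 0`, `D̄ = ∂ⱼ − cQ(x_j)∂ᵢ` (`i ≠ j`). [folklore] -/
theorem integral_slotDeriv_mul_add (hij : i ≠ j) (Q : ShearProfile) (c : ℝ) {a b : UnitAddTorus (Fin 2) → ℝ}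
    (ha : IsSmooth a) (hb : IsSmooth b) :
    (∫ x, (partialDeriv j a x - c * Q.onCircle (x j) * partialDeriv i a x) * b x) +
      ∫ x, a x * (partialDeriv j b x - c * Q.onCircle (x j) * partialDeriv i b x) = 0 := by
  have hQb : IsSmooth (fun x : UnitAddTorus (Fin 2) => Q.onCircle (x j) * b x) :=
    (isSmooth_onCircle_comp' Q j).mul hb
  have h1 := integral_partialDeriv_mul_add ha hb j
  have h2 := integral_partialDeriv_mul_add ha hQb i
  simp_rw [partialDeriv_i_onCircle_mul hij Q hb] at h2
  have e1 : (fun x => (partialDeriv j a x - c * Q.onCircle (x j) * partialDeriv i a x) * b x) =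
      fun x => partialDeriv j a x * b x - c * (partialDeriv i a x * (Q.onCircle (x j) * b x)) := by
    funext x; ring
  have e2 : (fun x => a x * (partialDeriv j b x - c * Q.onCircle (x j) * partialDeriv i b x)) =
      fun x => a x * partialDeriv j b x - c * (a x * (Q.onCircle (x j) * partialDeriv i b x)) := by
    funext x; ring
  have i1 : Integrable (fun x => partialDeriv j a x * b x) volume :=
    ((ha.partialDeriv j).continuous.mul hb.continuous).integrable_unitAddTorus
  have i2 : Integrable (fun x => c * (partialDeriv i a x * (Q.onCircle (x j) * b x))) volume :=
    (((ha.partialDeriv i).continuous.mul hQb.continuous).integrable_unitAddTorus).const_mul c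
  have i3 : Integrable (fun x => a x * partialDeriv j b x) volume :=
    (ha.continuous.mul (hb.partialDeriv j).continuous).integrable_unitAddTorus
  have i4 : Integrable (fun x => c * (a x * (Q.onCircle (x j) * partialDeriv i b x))) volume :=
    ((ha.continuous.mul ((isSmooth_onCircle_comp' Q j).continuous.mul
      (hb.partialDeriv i).continuous)).integrable_unitAddTorus).const_mul c
  rw [e1, e2, integral_sub i1 i2, integral_sub i3 i4, integral_const_mul, integral_const_mul]
  linear_combination h1 - c * h2

/-! ## §2 `L²` tools -/

/-- Cauchy–Schwarz for smooth real functions on the torus: `|∫ f g| ≤ √∫f² · √∫g²`. [folklore] -/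
theorem abs_integral_mul_le {f g : UnitAddTorus (Fin 2) → ℝ} (hf : IsSmooth f) (hg : IsSmooth g) :
    |∫ x, f x * g x| ≤ Real.sqrt (∫ x, f x ^ 2) * Real.sqrt (∫ x, g x ^ 2) := by
  have h1 := FluidPDE.integral_mul_le_sqrt_mul_sqrt_of_memLp (hf.memLp 2) (hg.memLp 2)
  have h2 := FluidPDE.integral_mul_le_sqrt_mul_sqrt_of_memLp (hf.neg.memLp 2) (hg.memLp 2)
  simp only [Pi.neg_apply, neg_mul, integral_neg, even_two.neg_pow] at h2
  exact abs_le.2 ⟨by linarith, h1⟩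

/-- If `|f| ≤ ε |g|` pointwise then `√∫f² ≤ ε √∫g²` (`ε ≥ 0`, smooth `f, g`). [folklore] -/
theorem sqrt_integral_sq_le_of_abs_le {f g : UnitAddTorus (Fin 2) → ℝ} (hg : IsSmooth g)
    {ε : ℝ} (hε : 0 ≤ ε) (h : ∀ x, |f x| ≤ ε * |g x|) :
    Real.sqrt (∫ x, f x ^ 2) ≤ ε * Real.sqrt (∫ x, g x ^ 2) := by
  have hle : ∫ x, f x ^ 2 ≤ ∫ x, ε ^ 2 * g x ^ 2 := by
    have hg2 : IsSmooth (fun x => g x ^ 2) := hg.pow 2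
    refine integral_mono_of_nonneg (Eventually.of_forall fun x => sq_nonneg _)
      (hg2.integrable.const_mul _) (Eventually.of_forall fun x => ?_)
    have := h x
    have h2 : |f x| ^ 2 ≤ (ε * |g x|) ^ 2 := pow_le_pow_left₀ (abs_nonneg _) this 2
    simpa [sq_abs, mul_pow] using h2
  rw [integral_const_mul] at hle
  calc Real.sqrt (∫ x, f x ^ 2) ≤ Real.sqrt (ε ^ 2 * ∫ x, g x ^ 2) := Real.sqrt_le_sqrt hle
    _ = ε * Real.sqrt (∫ x, g x ^ 2) := by
        rw [Real.sqrt_mul (sq_nonneg _), Real.sqrt_sq hε]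


/-! ## §3 The real trigonometric polynomial `h`: norms against `F` -/

/-- `∑_l (eᵢ)_l v_l = vᵢ` on `Fin 2`. [folklore] -/
theorem sum_single_mul (i : Fin 2) (v : Fin 2 → ℝ) : ∑ l, (Pi.single i (1 : ℝ) : Fin 2 → ℝ) l * v l = v i := by
  rw [Fin.sum_univ_two]
  fin_cases i <;> simp

/-- `∑_l (eⱼ − t eᵢ)_l v_l = vⱼ − t vᵢ` on `Fin 2`. [folklore] -/
theorem sum_single_sub_mul (i j : Fin 2) (t : ℝ) (v : Fin 2 → ℝ) :
    ∑ l, ((Pi.single j (1 : ℝ) : Fin 2 → ℝ) l - t * (Pi.single i (1 : ℝ) : Fin 2 → ℝ) l) * v l = v j - t * v i := by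
  rw [Fin.sum_univ_two]
  fin_cases i <;> fin_cases j <;> simp <;> ring

/-- `‖h‖_{L²} ≤ √(∑_{k∈S} w |𝓕F|²)` for `h = Re ∑_{k∈S} w 𝓕F e_k`, `0 ≤ w ≤ 1`. [cite: Grafakos2014, Prop. 3.2.7 (3)] -/
theorem sqrt_integral_reTrig_sq_le (S : Finset (Fin 2 → ℤ)) {w : (Fin 2 → ℤ) → ℝ} (hw0 : ∀ k, 0 ≤ w k)
    (hw1 : ∀ k, w k ≤ 1) (F : UnitAddTorus (Fin 2) → ℝ) :
    Real.sqrt (∫ x, (∑ k ∈ S, ((w k : ℂ) * mFourierCoeff (fun y => (F y : ℂ)) k) * mFourier k x).re ^ 2) ≤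
      Real.sqrt (∑ k ∈ S, w k * ‖mFourierCoeff (fun y => (F y : ℂ)) k‖ ^ 2) := by
  refine Real.sqrt_le_sqrt ((integral_re_trigPoly_sq_le S _).trans (Finset.sum_le_sum fun k _ => ?_))
  rw [norm_mul, mul_pow, Complex.norm_real, Real.norm_eq_abs, abs_of_nonneg (hw0 k)]
  have : w k ^ 2 ≤ w k := by nlinarith [hw0 k, hw1 k]
  exact mul_le_mul_of_nonneg_right this (sq_nonneg _)

/-- `‖D_α h‖_{L²} ≤ ‖D_α F‖_{L²}` for `h = Re ∑_{k∈S} w 𝓕F e_k`, `0 ≤ w ≤ 1`, smooth real `F`.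
[cite: Grafakos2014, Prop. 3.2.7 (3)] -/
theorem sqrt_integral_dirDeriv_reTrig_sq_le (α : Fin 2 → ℝ) (S : Finset (Fin 2 → ℤ)) {w : (Fin 2 → ℤ) → ℝ}
    (hw0 : ∀ k, 0 ≤ w k) (hw1 : ∀ k, w k ≤ 1) {F : UnitAddTorus (Fin 2) → ℝ} (hF : IsSmooth F) :
    Real.sqrt (∫ x, (∑ l, α l * partialDeriv l (fun x : UnitAddTorus (Fin 2) =>
        (∑ k ∈ S, ((w k : ℂ) * mFourierCoeff (fun y => (F y : ℂ)) k) * mFourier k x).re) x) ^ 2) ≤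
      Real.sqrt (∫ x, (∑ l, α l * partialDeriv l F x) ^ 2) := by
  refine Real.sqrt_le_sqrt ((integral_dirDeriv_re_trigPoly_sq_le α S _).trans
    ((Finset.sum_le_sum fun k _ => ?_).trans (sum_le_integral_dirDeriv_sq α hF S)))
  rw [norm_mul, mul_pow, Complex.norm_real, Real.norm_eq_abs, abs_of_nonneg (hw0 k)]
  have : w k ^ 2 ≤ 1 := by nlinarith [hw0 k, hw1 k]
  have h4 : 0 ≤ 4 * Real.pi ^ 2 * (∑ l, α l * ((k l : ℤ) : ℝ)) ^ 2 := by positivity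
  calc 4 * Real.pi ^ 2 * (∑ l, α l * ((k l : ℤ) : ℝ)) ^ 2 * (w k ^ 2 * ‖mFourierCoeff (fun y => (F y : ℂ)) k‖ ^ 2)
      ≤ 4 * Real.pi ^ 2 * (∑ l, α l * ((k l : ℤ) : ℝ)) ^ 2 * (1 * ‖mFourierCoeff (fun y => (F y : ℂ)) k‖ ^ 2) := by
        gcongr
    _ = _ := by rw [one_mul]

end Pairing

end Summit.AnomalousDissipation.AnomalousDissipation.Theorems.SawtoothPulseCascade.K1Slot
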